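/-
Copyright: the b2b-balaban T⁴-continuum CRUX team, row NE7b OWNER lineage `t4-ne7b-p1` (gen 123). Project licence.
-/
import Summits.QuantumFields.BalabanUV.T4Continuum.Spine.NE7b.SupTorusTowerComparison

/-!
# THE THERMODYNAMIC LIMIT OF THE ROAD'S LINEAR COLUMN: for EVERY potential `V : ℤ^d → [−λ, Λ]` (`λ < min(2,a)`, NO periodicity) and every
# bounded source `f` on `ℤ^d`, the torus solutions of `H_k u_k = f∘wm_k` (data read through the centred windows of the tori of coarse
# periods `3^k`) CONVERGE pointwise on `ℤ^d`, and the limit `u` SOLVES `((n+1)²(−Δ) + a(n+1)^{−d}·(block sums) + V)u = f` ON `ℤ^d` with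
# `|u| ≤ C·‖f‖_∞`; for a source supported in one block `b₀`, `e^{δ|blk n p − b₀|₁}·|u p| ≤ C·‖f‖_∞` at EVERY `p ∈ ℤ^d` — the infinite-volume
# propagator of the road's class, `d ≥ 3`, every mesh, constants from `(d, a, λ, Λ)` and `C(d)` only (row NE7b, node U5c; (148)∕(152)∕(155)∕
# (179) BY NAME; [folklore])

Cell `pub-balaban`, sub-cell `t4`, spine estimate NE7b (`T4WeightBudget.RelWeightBound`; the cell's OWN estimate — NOT PRINTED in
[Bałaban 1983–89], NOT PROVED).  Crux-route work under `Spine/NE7b/` by the row OWNER (`t4-ne7b-p1` gen 123, file (180)) under FREEZE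
(0)'s crux-prover clause; NOTHING of Bałaban's is named as a Lean object, valued or asserted; no `T4Continuum/Support` leaf typed; no `def`,
no notation (the `ℤ^d` operator DISPLAYED; the limit object is an `∃ u : ℤ^d → ℝ`); zero `sorry`.  Imports (BY NAME): the OWNER's (179)
`…SupTorusTowerComparison` (`tower_comparison`, `cover_proj`; through it (155) `propagator_pointwise_decay_road`, (152) `supNorm_bound_road`,
(148) `action_surjective`, (132) `natAbs_valMinAbs_le_of_intCast_eq`, TDF `blockOf_siteOf`, the Literature window kit `Beta.InfiniteVolume`
and `Beta.siteOf_add` ∕ `siteOf_sub`), Mathlib's `cauchySeq_of_dist_le_of_summable`, `cauchySeq_tendsto_of_complete`, `tendsto_nhds_unique`.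

WHY (located).  § [NE7bP1-G122-HANDOFF] NEXT (3)(c): every HONEST line of the column says «rung (B)+1 on a FINITE torus — NOT infinite
volume».  For the LINEAR column the infinite volume is now a theorem: by (179) two consecutive levels `3^k ∣ 3^{k+1}` of the tower, fed the
window readings of the same `ℤ^d` data, differ at `σ_{k+1}p` by `≤ C·M·e^{δ|blk n p|₁}·e^{−δ(3^k∕2 − 2)}` (`σ_k(wm_{k+1}(σ_{k+1}p)) = σ_k p` by
(179) `cover_proj`; `ρ(σ b, 0) ≤ |b|₁` by minimality of centred representatives), which is summable in `k` (`3^k ≥ k`): the lifts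
`u_k∘σ_k` are Cauchy at every `p`, hence converge (`ℝ` complete).  For `k` beyond the window radius of `p` the torus equation at `σ_k p` IS
the `ℤ^d` equation at `p` for the lift (`wm_k(σ_k p) = p`, `σ(p ± ê) = σ p ± σ ê`), so the limit solves it (finite sums pass to the limit);
(152)'s sup bound and (155)'s weighted bound (torus distance = `ℓ¹` distance beyond the window radius) pass to the limit.

WHAT IS PROVED ([folklore]; `X d = ℤ^d`; `T_k = Site d ((n+1)3^k)`; `σ_k`, `wm_k` the projection and the centred window map; the `ℤ^d`
operator `(Hu)(p) = (n+1)²Σ_μ(2u p − u(p + ê_μ) − u(p − ê_μ)) + a(n+1)^{−d}Σ_{q ∈ B n (blk n p)}u q + V p·u p` DISPLAYED):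
* §1 `natAbs_valMinAbs_intCast_of_lt` (`2|z| < N` ⟹ `|valMinAbs (z : ZMod N)| = |z|`), `torusNorm_le_l1` (`Σ_i|valMinAbs((σ_s b) i)| ≤ |b|₁`),
  `torusDist_eq_l1_of_lt` (`2|b i − c i| < s` ∀ `i` ⟹ `ρ_s(σ b, σ c) = |b − c|₁`), `inWindow_of_le` (`2|p|₁ + 1 ≤ k` ⟹ `p` in the window of `T_k`).
* §2 **`tower_limit`**: for `V : ℤ^d → [−λ, Λ]`, `|f| ≤ M` and ANY family of solutions `u_k` of the torus equations with data `V∘wm_k`,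
  `f∘wm_k`: `∃ u : ℤ^d → ℝ` with `Hu = f` on `ℤ^d` and `u_k(σ_k p) → u p` for every `p`.
* §3 THE HEADLINES **`zd_solution_exists`** (`d ≥ 3`, `a > 0`, `λ < min(2,a)`, `Λ ≥ 0` ⟹ `∃ C > 0`: for ALL `n`, ALL `V : ℤ^d → [−λ, Λ]`,
  every `|f| ≤ M`: `∃ u`, `Hu = f` on `ℤ^d` and `|u p| ≤ C·M`) and **`zd_propagator_exists`** (`∃ C δ > 0`: … every `f` supported in the
  block `b₀` with `|f| ≤ M`: `∃ u`, `Hu = f` on `ℤ^d` and `e^{δΣ_i|blk n p i − b₀ i|}·|u p| ≤ C·M` at every `p`).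
* §4 toy (`d = 3`).

HONEST (what this is NOT).  Existence with bounds, NOT uniqueness in a stated class (the limit is canonical only through the construction;
uniqueness among bounded solutions is the sequel); `d ≥ 3` only; the LINEAR column only (no measure, no interacting object in infinite
volume); constants existential and far from sharp; scalar skeleton ((A3), NC-NE7b-α UNRULED); nothing of the covariant propagators of
[B4]–[B6]; nothing of Bałaban's.  BY-NAME EFFECT ON THE WALL: NONE.  NE7b NOT PRINTED ∕ NOT PROVED; spine PROVED 0∕9; rung (B)+1 — the
programme's measures remain FINITE-torus statements; NOT the mass gap, NOT Clay.  HONEST DEPENDENCY: continuum YM on T⁴ ⇐ BetaPertH ∧ nine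
spine estimates (0∕9 proved); BetaPertH ⇐ (D1) ∧ (D4) ∧ CAP+tail; G-an2-4 gates asym, D1 and NE2∕3∕4.
-/

set_option autoImplicit false

noncomputable section

namespace Summit.QuantumFields.BalabanUV.T4Continuum.NE7b.SupZdPropagatorLimit

open Real Filter Topology
open Literature.MathematicalPhysics.QuantumFieldTheory.Balaban1983to89
open B6QGQLower276 (X e blk B side side_facts chart mem_B sum_B sum_B_const card_cube blk_chart)
open Beta (Site siteOf windowMap siteOf_windowMap siteOf_add siteOf_sub InWindow windowMap_siteOf inWindow_windowMap
  inWindow_of_two_mul_abs_lt)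
open SupTorusDirichletForm (blockOf_siteOf)
open SupTorusBlockDistance (natAbs_valMinAbs_le_of_intCast_eq)
open SupTorusSupNormBound (action_surjective)
open SupTorusSupNormRoad (supNorm_bound_road)
open SupTorusPointwiseRoadColumn (propagator_pointwise_decay_road)
open SupTorusTowerComparison (tower_comparison cover_proj)

variable {d : ℕ}

/-! ## §1. Centred representatives of small integers; torus distance vs `ℓ¹` distance; windows exhaust `ℤ^d` -/

/-- **SMALL INTEGERS ARE THEIR OWN CENTRED REPRESENTATIVES (in absolute value)**: `2|z| < N` ⟹ `|valMinAbs (z : ZMod N)| = |z|` —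
minimality gives `≤`; conversely `z − valMinAbs z` is a multiple of `N`, nonzero multiples being `≥ N > 2|z|` in size. [folklore] -/
theorem natAbs_valMinAbs_intCast_of_lt (N : ℕ) [NeZero N] (z : ℤ) (hz : 2 * z.natAbs < N) : ((z : ZMod N)).valMinAbs.natAbs = z.natAbs := by
  set v : ℤ := ((z : ZMod N)).valMinAbs with hv
  have hle : v.natAbs ≤ z.natAbs := natAbs_valMinAbs_le_of_intCast_eq (s := N) (z : ZMod N) z rfl
  refine le_antisymm hle ?_
  have hcoe : ((v : ZMod N)) = ((z : ℤ) : ZMod N) := by rw [hv]; exact ZMod.coe_valMinAbs _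
  obtain ⟨m, hm⟩ := (ZMod.intCast_eq_intCast_iff_dvd_sub v z N).1 hcoe
  by_cases hm0 : m = 0
  · rw [hm0, mul_zero, sub_eq_zero] at hm; rw [hm]
  · have hm1 : 1 ≤ |m| := Int.one_le_abs hm0
    have hN0 : (0 : ℤ) ≤ N := by positivity
    have h1 : (N : ℤ) ≤ |z - v| := by rw [hm, abs_mul, abs_of_nonneg hN0]; exact le_mul_of_one_le_right hN0 hm1
    have h2 : |z - v| ≤ |z| + |v| := abs_sub _ _
    have hz' : 2 * |z| < N := by rw [← Int.natCast_natAbs]; exact_mod_cast hz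
    have h3 : |z| ≤ |v| := by linarith
    have h4 : ((z.natAbs : ℕ) : ℤ) ≤ ((v.natAbs : ℕ) : ℤ) := by rwa [Int.natCast_natAbs, Int.natCast_natAbs]
    exact_mod_cast h4

/-- **THE TORUS NORM OF A PROJECTED POINT IS AT MOST ITS `ℓ¹` NORM**: `Σ_i|valMinAbs((σ_s b) i)| ≤ Σ_i|b i|`. [folklore] -/
theorem torusNorm_le_l1 (s : ℕ) [NeZero s] (b : X d) :
    ∑ i, ((((siteOf d s b) i).valMinAbs.natAbs : ℕ) : ℝ) ≤ ∑ i, (((b i).natAbs : ℕ) : ℝ) :=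
  Finset.sum_le_sum fun i _ => by exact_mod_cast natAbs_valMinAbs_le_of_intCast_eq (s := s) ((siteOf d s b) i) (b i) rfl

/-- **BEYOND THE WINDOW RADIUS THE TORUS DISTANCE IS THE `ℓ¹` DISTANCE**: `2|b i − c i| < s` for all `i` ⟹ `ρ_s(σ b, σ c) = Σ_i|b i − c i|`.
[folklore] -/
theorem torusDist_eq_l1_of_lt (s : ℕ) [NeZero s] (b c : X d) (h : ∀ i, 2 * (b i - c i).natAbs < s) :
    ∑ i, ((((siteOf d s b) i - (siteOf d s c) i).valMinAbs.natAbs : ℕ) : ℝ) = ∑ i, (((b i - c i).natAbs : ℕ) : ℝ) := by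
  refine Finset.sum_congr rfl fun i _ => ?_
  have hc : (siteOf d s b) i - (siteOf d s c) i = (((b i - c i : ℤ)) : ZMod s) := by simp [siteOf, Int.cast_sub]
  rw [hc, natAbs_valMinAbs_intCast_of_lt s (b i - c i) (h i)]

/-- **THE WINDOWS EXHAUST `ℤ^d`**: if `2Σ_i|p i| + 1 ≤ k` then `p` lies in the centred window of the fine torus of period `(n+1)3^k` (`3^k > k`).
[folklore] -/
theorem inWindow_of_le (n k : ℕ) (p : X d) (hk : 2 * ∑ i, (p i).natAbs + 1 ≤ k) (i : Fin d) : InWindow ((n + 1) * 3 ^ k) (p i) := by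
  classical
  refine inWindow_of_two_mul_abs_lt ?_
  have h1 : (p i).natAbs ≤ ∑ j, (p j).natAbs :=
    Finset.single_le_sum (f := fun j => (p j).natAbs) (fun _ _ => Nat.zero_le _) (Finset.mem_univ i)
  have h2 : k < 3 ^ k := Nat.lt_pow_self (by norm_num)
  have h3 : 3 ^ k ≤ (n + 1) * 3 ^ k := Nat.le_mul_of_pos_left _ (Nat.succ_pos n)
  have h4 : 2 * (p i).natAbs < (n + 1) * 3 ^ k := by omega
  have h5 : (2 : ℤ) * ((p i).natAbs : ℤ) < (((n + 1) * 3 ^ k : ℕ) : ℤ) := by exact_mod_cast h4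
  rwa [Int.natCast_natAbs] at h5

/-! ## §2. The tower limit: any family of torus solutions with window data converges to a `ℤ^d` solution -/

/-- **THE TOWER LIMIT**: `V : ℤ^d → [−λ, Λ]`, `|f| ≤ M`, and ANY family `u_k` of solutions of the torus equations on `T_k = Site d ((n+1)3^k)`
with the window data `V∘wm_k`, `f∘wm_k` ⟹ `∃ u : ℤ^d → ℝ` solving the displayed `ℤ^d` equation with `u_k(σ_k p) → u p` at every `p` —
(179) between consecutive levels (summable in `k`), completeness of `ℝ`, and the `ℤ^d` reading of the torus equation beyond the window
radius of `p`. [folklore] -/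
theorem tower_limit (hd : 3 ≤ d) (a : ℝ) (ha : 0 < a) {lam Lam : ℝ} (hlam : lam < min 2 a) (hLam : 0 ≤ Lam) (n : ℕ)
    (V : X d → ℝ) (hV : ∀ p, -lam ≤ V p) (hV' : ∀ p, V p ≤ Lam) {M : ℝ} (f : X d → ℝ) (hfM : ∀ p, |f p| ≤ M)
    (useq : (k : ℕ) → Site d ((n + 1) * 3 ^ k) → ℝ)
    (husol : ∀ (k : ℕ) (x : Site d ((n + 1) * 3 ^ k)),
      ((n : ℝ) + 1) ^ 2 * ∑ μ, (2 * useq k x - useq k (x + siteOf d ((n + 1) * 3 ^ k) (e μ)) - useq k (x - siteOf d ((n + 1) * 3 ^ k) (e μ)))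
        + a / ((n : ℝ) + 1) ^ d * ∑ q ∈ B n (blk n (windowMap d ((n + 1) * 3 ^ k) x)), useq k (siteOf d ((n + 1) * 3 ^ k) q)
        + V (windowMap d ((n + 1) * 3 ^ k) x) * useq k x = f (windowMap d ((n + 1) * 3 ^ k) x)) :
    ∃ u : X d → ℝ,
      (∀ p, ((n : ℝ) + 1) ^ 2 * ∑ μ, (2 * u p - u (p + e μ) - u (p - e μ))
        + a / ((n : ℝ) + 1) ^ d * ∑ q ∈ B n (blk n p), u q + V p * u p = f p) ∧
      (∀ p, Tendsto (fun k => useq k (siteOf d ((n + 1) * 3 ^ k) p)) atTop (𝓝 (u p))) := by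
  classical
  obtain ⟨C, δ, hC, hδ, H179⟩ := tower_comparison (d := d) hd a ha hlam hLam
  have hM : 0 ≤ M := (abs_nonneg _).trans (hfM 0)
  set r : ℝ := exp (-(δ / 2)) with hr
  have hr0 : 0 ≤ r := (exp_pos _).le
  have hr1 : r < 1 := exp_lt_one_iff.2 (by linarith)
  -- the Cauchy estimate between consecutive levels
  have hstep : ∀ (k : ℕ) (p : X d), |useq (k + 1) (siteOf d ((n + 1) * 3 ^ (k + 1)) p) - useq k (siteOf d ((n + 1) * 3 ^ k) p)|
      ≤ C * M * exp (δ * ∑ i, (((blk n p i).natAbs : ℕ) : ℝ)) * exp (2 * δ) * r ^ k := by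
    intro k p
    have h := H179 n (3 ^ k) 3 V hV hV' M f hfM (useq k) (husol k) (useq (k + 1)) (husol (k + 1))
      (siteOf d ((n + 1) * (3 ^ k * 3)) p)
    rw [cover_proj n (3 ^ k) 3 p, blockOf_siteOf n (3 ^ k * 3) p] at h
    have hw : exp (δ * ∑ i, ((((siteOf d (3 ^ k * 3) (blk n p)) i).valMinAbs.natAbs : ℕ) : ℝ))
        ≤ exp (δ * ∑ i, (((blk n p i).natAbs : ℕ) : ℝ)) :=
      exp_le_exp.2 (mul_le_mul_of_nonneg_left (torusNorm_le_l1 (d := d) (3 ^ k * 3) (blk n p)) hδ.le)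
    have hk : (k : ℝ) ≤ (3 : ℝ) ^ k := by exact_mod_cast (Nat.lt_pow_self (by norm_num : 1 < 3) (n := k)).le
    have hrate : exp (-(δ * ((((3 ^ k : ℕ)) : ℝ) / 2 - 2))) ≤ exp (2 * δ) * r ^ k := by
      rw [hr, ← Real.exp_nat_mul, ← exp_add]
      push_cast
      exact exp_le_exp.2 (by nlinarith)
    calc |useq (k + 1) (siteOf d ((n + 1) * 3 ^ (k + 1)) p) - useq k (siteOf d ((n + 1) * 3 ^ k) p)|
        ≤ C * M * exp (δ * ∑ i, ((((siteOf d (3 ^ k * 3) (blk n p)) i).valMinAbs.natAbs : ℕ) : ℝ))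
            * exp (-(δ * ((((3 ^ k : ℕ)) : ℝ) / 2 - 2))) := h
      _ ≤ C * M * exp (δ * ∑ i, (((blk n p i).natAbs : ℕ) : ℝ)) * (exp (2 * δ) * r ^ k) :=
          mul_le_mul (mul_le_mul_of_nonneg_left hw (by positivity)) hrate (exp_pos _).le (by positivity)
      _ = _ := by ring
  -- Cauchy, hence convergent, at every point
  have hcauchy : ∀ p, CauchySeq (fun k => useq k (siteOf d ((n + 1) * 3 ^ k) p)) := fun p =>
    cauchySeq_of_dist_le_of_summable (fun k => C * M * exp (δ * ∑ i, (((blk n p i).natAbs : ℕ) : ℝ)) * exp (2 * δ) * r ^ k)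
      (fun k => by rw [Real.dist_eq, abs_sub_comm]; exact hstep k p)
      ((summable_geometric_of_lt_one hr0 hr1).mul_left _)
  choose u hu using fun p => cauchySeq_tendsto_of_complete (hcauchy p)
  refine ⟨u, fun p => ?_, hu⟩
  -- beyond the window radius of `p`, the torus equation at `σ_k p` is the `ℤ^d` equation for the lift
  set k₀ : ℕ := 2 * ∑ i, (p i).natAbs + 1 with hk₀
  have hread : ∀ k, k₀ ≤ k →
      ((n : ℝ) + 1) ^ 2 * ∑ μ, (2 * useq k (siteOf d ((n + 1) * 3 ^ k) p) - useq k (siteOf d ((n + 1) * 3 ^ k) (p + e μ))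
          - useq k (siteOf d ((n + 1) * 3 ^ k) (p - e μ)))
        + a / ((n : ℝ) + 1) ^ d * ∑ q ∈ B n (blk n p), useq k (siteOf d ((n + 1) * 3 ^ k) q)
        + V p * useq k (siteOf d ((n + 1) * 3 ^ k) p) = f p := by
    intro k hk
    have hwin : windowMap d ((n + 1) * 3 ^ k) (siteOf d ((n + 1) * 3 ^ k) p) = p :=
      windowMap_siteOf d ((n + 1) * 3 ^ k) (inWindow_of_le n k p (by rw [hk₀] at hk; exact hk))
    have h := husol k (siteOf d ((n + 1) * 3 ^ k) p)
    rw [hwin] at h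
    simp only [← siteOf_add, ← siteOf_sub] at h
    exact h
  -- the left-hand sides converge to the `ℤ^d` left-hand side at `u`
  have hT : Tendsto (fun k => ((n : ℝ) + 1) ^ 2 * ∑ μ, (2 * useq k (siteOf d ((n + 1) * 3 ^ k) p)
        - useq k (siteOf d ((n + 1) * 3 ^ k) (p + e μ)) - useq k (siteOf d ((n + 1) * 3 ^ k) (p - e μ)))
        + a / ((n : ℝ) + 1) ^ d * ∑ q ∈ B n (blk n p), useq k (siteOf d ((n + 1) * 3 ^ k) q)
        + V p * useq k (siteOf d ((n + 1) * 3 ^ k) p)) atTop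
      (𝓝 (((n : ℝ) + 1) ^ 2 * ∑ μ, (2 * u p - u (p + e μ) - u (p - e μ))
        + a / ((n : ℝ) + 1) ^ d * ∑ q ∈ B n (blk n p), u q + V p * u p)) := by
    refine Tendsto.add (Tendsto.add ?_ ?_) ((hu p).const_mul (V p))
    · exact (tendsto_finsetSum _ fun μ _ => (((hu p).const_mul 2).sub (hu (p + e μ))).sub (hu (p - e μ))).const_mul _
    · exact (tendsto_finsetSum _ fun q _ => hu q).const_mul _
  have hT' : Tendsto (fun k => ((n : ℝ) + 1) ^ 2 * ∑ μ, (2 * useq k (siteOf d ((n + 1) * 3 ^ k) p)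
        - useq k (siteOf d ((n + 1) * 3 ^ k) (p + e μ)) - useq k (siteOf d ((n + 1) * 3 ^ k) (p - e μ)))
        + a / ((n : ℝ) + 1) ^ d * ∑ q ∈ B n (blk n p), useq k (siteOf d ((n + 1) * 3 ^ k) q)
        + V p * useq k (siteOf d ((n + 1) * 3 ^ k) p)) atTop (𝓝 (f p)) := by
    refine tendsto_const_nhds.congr' ?_
    exact Filter.eventually_atTop.2 ⟨k₀, fun k hk => (hread k hk).symm⟩
  exact tendsto_nhds_unique hT hT'

/-! ## §3. THE END: the infinite-volume solution and the infinite-volume propagator of the road's class -/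

/-- **HEADLINE (every bounded source) — THE `ℤ^d` EQUATION `((n+1)²(−Δ) + a(n+1)^{−d}·blocks + V)u = f` HAS A SOLUTION WITH `|u| ≤ C·‖f‖_∞`
FOR EVERY `V : ℤ^d → [−λ, Λ]`, `d ≥ 3`, every mesh**, `C` from `(d, a, λ, Λ)` and `C(d)` only: the tower limit (§2) of the torus solutions
((148) `action_surjective`), (152)'s mesh- and volume-free sup bound passing to the limit. [folklore] -/
theorem zd_solution_exists (hd : 3 ≤ d) (a : ℝ) (ha : 0 < a) {lam Lam : ℝ} (hlam : lam < min 2 a) (hLam : 0 ≤ Lam) :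
    ∃ C : ℝ, 0 < C ∧ ∀ (n : ℕ) (V : X d → ℝ), (∀ p, -lam ≤ V p) → (∀ p, V p ≤ Lam) →
      ∀ (M : ℝ) (f : X d → ℝ), (∀ p, |f p| ≤ M) →
      ∃ u : X d → ℝ,
        (∀ p, ((n : ℝ) + 1) ^ 2 * ∑ μ, (2 * u p - u (p + e μ) - u (p - e μ))
          + a / ((n : ℝ) + 1) ^ d * ∑ q ∈ B n (blk n p), u q + V p * u p = f p) ∧
        (∀ p, |u p| ≤ C * M) := by
  classical
  obtain ⟨C, hC, H152⟩ := supNorm_bound_road (d := d) hd a ha hlam hLam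
  refine ⟨C, hC, ?_⟩
  intro n V hV hV' M f hfM
  have hm0 : 0 < min 2 a - lam := by linarith
  choose useq husol using fun k : ℕ => action_surjective n a (3 ^ k) ha.le hm0 (fun x => V (windowMap d ((n + 1) * 3 ^ k) x))
    (fun x => hV _) (fun x => f (windowMap d ((n + 1) * 3 ^ k) x))
  obtain ⟨u, hueq, hlim⟩ := tower_limit hd a ha hlam hLam n V hV hV' f hfM useq husol
  refine ⟨u, hueq, fun p => ?_⟩
  have hbd : ∀ k, |useq k (siteOf d ((n + 1) * 3 ^ k) p)| ≤ C * M := fun k =>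
    H152 n (3 ^ k) (fun x => V (windowMap d ((n + 1) * 3 ^ k) x)) (fun x => hV _) (fun x => hV' _) M (useq k)
      (fun x => f (windowMap d ((n + 1) * 3 ^ k) x)) (fun x => hfM _) (husol k) _
  exact le_of_tendsto (hlim p).abs (Filter.Eventually.of_forall hbd)

/-- **HEADLINE (block sources) — THE INFINITE-VOLUME PROPAGATOR OF THE ROAD'S CLASS DECAYS EXPONENTIALLY AT THE BLOCK SCALE**: `d ≥ 3`,
`a > 0`, `λ < min(2,a)`, `Λ ≥ 0` ⟹ `∃ C δ > 0` such that for ALL `n`, ALL `V : ℤ^d → [−λ, Λ]`, every block `b₀` and every `f` supported in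
`B n b₀` with `|f| ≤ M`: there is `u : ℤ^d → ℝ` with `Hu = f` on `ℤ^d` and `e^{δΣ_i|blk n p i − b₀ i|}·|u p| ≤ C·M` at EVERY `p` — the tower
limit (§2) and (155) §1 at every level (torus distance = `ℓ¹` distance beyond the window radius of `blk n p − b₀`). [folklore] -/
theorem zd_propagator_exists (hd : 3 ≤ d) (a : ℝ) (ha : 0 < a) {lam Lam : ℝ} (hlam : lam < min 2 a) (hLam : 0 ≤ Lam) :
    ∃ C δ : ℝ, 0 < C ∧ 0 < δ ∧ ∀ (n : ℕ) (V : X d → ℝ), (∀ p, -lam ≤ V p) → (∀ p, V p ≤ Lam) →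
      ∀ (b₀ : X d) (M : ℝ) (f : X d → ℝ), (∀ p, blk n p ≠ b₀ → f p = 0) → (∀ p, |f p| ≤ M) →
      ∃ u : X d → ℝ,
        (∀ p, ((n : ℝ) + 1) ^ 2 * ∑ μ, (2 * u p - u (p + e μ) - u (p - e μ))
          + a / ((n : ℝ) + 1) ^ d * ∑ q ∈ B n (blk n p), u q + V p * u p = f p) ∧
        (∀ p, exp (δ * ∑ i, (((blk n p i - b₀ i).natAbs : ℕ) : ℝ)) * |u p| ≤ C * M) := by
  classical
  obtain ⟨C, δ, hC, hδ, H155⟩ := propagator_pointwise_decay_road (d := d) hd a ha hlam hLam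
  refine ⟨C, δ, hC, hδ, ?_⟩
  intro n V hV hV' b₀ M f hf hfM
  have hm0 : 0 < min 2 a - lam := by linarith
  choose useq husol using fun k : ℕ => action_surjective n a (3 ^ k) ha.le hm0 (fun x => V (windowMap d ((n + 1) * 3 ^ k) x))
    (fun x => hV _) (fun x => f (windowMap d ((n + 1) * 3 ^ k) x))
  obtain ⟨u, hueq, hlim⟩ := tower_limit hd a ha hlam hLam n V hV hV' f hfM useq husol
  refine ⟨u, hueq, fun p => ?_⟩
  -- the window reading of `f` is supported in the torus block `σ b₀`
  have hfk : ∀ (k : ℕ) (x : Site d ((n + 1) * 3 ^ k)),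
      siteOf d (3 ^ k) (blk n (windowMap d ((n + 1) * 3 ^ k) x)) ≠ siteOf d (3 ^ k) b₀ → f (windowMap d ((n + 1) * 3 ^ k) x) = 0 :=
    fun k x hx => hf _ fun hb => hx (by rw [hb])
  -- (155) §1 at every level
  have hdec : ∀ k : ℕ, exp (δ * ∑ i, ((((siteOf d (3 ^ k) (blk n (windowMap d ((n + 1) * 3 ^ k) (siteOf d ((n + 1) * 3 ^ k) p)))) i
      - (siteOf d (3 ^ k) b₀) i).valMinAbs.natAbs : ℕ) : ℝ)) * |useq k (siteOf d ((n + 1) * 3 ^ k) p)| ≤ C * M := fun k =>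
    H155 n (3 ^ k) (fun x => V (windowMap d ((n + 1) * 3 ^ k) x)) (fun x => hV _) (fun x => hV' _) (siteOf d (3 ^ k) b₀) M (useq k)
      (fun x => f (windowMap d ((n + 1) * 3 ^ k) x)) (hfk k) (fun x => hfM _) (husol k) _
  -- beyond the window radius of `blk n p − b₀` the torus distance is the `ℓ¹` distance
  set R : ℕ := ∑ i, (blk n p i - b₀ i).natAbs with hR
  have hev : ∀ᶠ k in atTop, exp (δ * ∑ i, (((blk n p i - b₀ i).natAbs : ℕ) : ℝ)) * |useq k (siteOf d ((n + 1) * 3 ^ k) p)| ≤ C * M := by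
    refine Filter.eventually_atTop.2 ⟨2 * R + 1, fun k hk => ?_⟩
    have hlt : ∀ i, 2 * (blk n p i - b₀ i).natAbs < 3 ^ k := fun i => by
      have h1 : (blk n p i - b₀ i).natAbs ≤ R :=
        Finset.single_le_sum (f := fun j => (blk n p j - b₀ j).natAbs) (fun _ _ => Nat.zero_le _) (Finset.mem_univ i)
      have h2 : k < 3 ^ k := Nat.lt_pow_self (by norm_num)
      omega
    have h := hdec k
    rw [blockOf_siteOf n (3 ^ k) p, torusDist_eq_l1_of_lt (3 ^ k) (blk n p) b₀ hlt] at h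
    exact h
  exact le_of_tendsto ((hlim p).abs.const_mul _) hev

/-! ## §4. Toy -/

/-- Toy (`d = 3`, `a = 1`, `λ = 0`, `Λ = 1`): the constants of the infinite-volume propagator exist. -/
example : ∃ C δ : ℝ, 0 < C ∧ 0 < δ :=
  let ⟨C, δ, hC, hδ, _⟩ := zd_propagator_exists (d := 3) le_rfl 1 one_pos (lam := 0) (Lam := 1)
    (by rw [min_eq_right (by norm_num : (1 : ℝ) ≤ 2)]; norm_num) zero_le_one
  ⟨C, δ, hC, hδ⟩

end Summit.QuantumFields.BalabanUV.T4Continuum.NE7b.SupZdPropagatorLimit
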